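import Literature.Probability.Distributions.IndepProductLawDistance
import Mathlib.Analysis.SpecificLimits.Basic
import Mathlib.Analysis.SpecialFunctions.Pow.Real
import Mathlib.Topology.MetricSpace.Pseudo.Defs
import HarnessLib

/-!
# The multiresolution total-variation pseudometric on laws of square states

Topic `Probability/Percolation`; definition request `defn-MultiResTV` (route `CardyGluingRDE` of the
sub-problem `CardyFormulaZ2`, summit `CriticalPhenomena`); companion of `GluingRDE.lean` (the
law-level gluing map `Ψ : PMF S → PMF S`; laws are Mathlib `PMF`s, distance `PMF.tvDist`) and of
`MultiResTVSegments.lean` (the route's concrete instance on boundary-segment matrices and the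
`rfl`-level bridge to the route file's inlined `Dw`/`TV`).

**The notion.** A finite model of percolation (Langlands–Pouliot–Saint-Aubin 1994, §2.3) attaches to
a square whose sides carry `l` boundary intervals a finite state space `A` ("which pairs of
boundary intervals are connected"); passing from `2l` to `l` subdivisions *fuses the intervals in
pairs*, and the renormalisation acts on the simplex `𝔛` of probability measures on `A`. Route
`CardyGluingRDE` compares two laws of resolution-`2^K` states SIMULTANEOUSLY AT ALL DYADIC
RESOLUTIONS `j ≤ K`, discounting the fine ones geometrically:
`Dw_{σ,K}(μ, ν) = ∑_{j ≤ K} 2^{-σ j} · Δ(π_j μ, π_j ν)`, where `π_j` coarsens a state to resolution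
`2^j` and `Δ = ½ ∑_s |μ s − ν s|` is total variation on the finite state space (the standard way to
metrise an inverse system from metrics on its stages, as for the product metric `∑ 2^{-j} d_j`,
with a tunable rate `σ`). Generic in the state spaces; nothing about percolation is asserted here.

* `tvFin f g = ½ ∑_s |f s − g s|` — total variation of two real mass vectors on a finite type, the
  form in which the route file inlines `TV_j` (vectors `M ↦ P_ℤ²[state_j = M]`, `M ↦ P_𝕋[…]`);
  `tvDist_eq_tvFin`: for `PMF`s it is the tree's `PMF.tvDist`.
* `multiResSum σ K d = ∑_{j ∈ range (K+1)} 2^{-(σ·j)} · d j` — literally the route's inlined `Dw`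
  applied to `d j = TV_j`; weights `multiResWeight σ j = 2^{-(σ·j)}`; nonnegativity, monotonicity in
  `d` and in `K`, additivity, `2^{-σ j} d j ≤ multiResSum` and `d j ≤ 2^{σ j} · multiResSum` (`j ≤ K`),
  the geometric bound `multiResSum ≤ ∑_{j ≤ K} 2^{-σ j} ≤ (1 − 2^{-σ})⁻¹` (`d ≤ 1`, `σ > 0`).
* `multiResTV π σ K μ ν` — THE PSEUDOMETRIC on `PMF S` for a coarsening family
  `π : (j : ℕ) → S → T j`: `multiResSum σ K (j ↦ Δ(μ.map (π j), ν.map (π j)))`. Pseudometric axioms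
  (packaged as the NON-instance `MultiResTV.pseudoMetricSpace`), `2^{-σ j} Δ_j ≤ Dw`,
  `Δ_j ≤ 2^{σ j} Dw` (`j ≤ K`), `Dw ≤ ∑_j 2^{-σ j} ≤ (1 − 2^{-σ})⁻¹`, `Dw ≤ (∑_j 2^{-σ j}) Δ(μ, ν)`
  (data processing), monotone in `K`, `multiResTV_comp` (consistency along the tower),
  `multiResSum_tvFin_eq_multiResTV` (bridge to real coordinates). That `Dw` is a genuine metric
  when the top projection `π K` is injective is in `MultiResTVSegments.lean`.

## References

* R. Langlands, P. Pouliot, Y. Saint-Aubin, *Conformal invariance in two-dimensional percolation*,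
  Bull. AMS 30 (1994) 1–61, §2.3 (finite models; "these intervals are then fused in pairs"; the
  simplex `𝔛` of measures on `A`) [LanglandsPouliotSaintaubin1994].
* O. Goldreich, *Foundations of Cryptography I* (2001), §3.2.1 (statistical = total-variation
  distance `½ ∑ |p − q|`; the tree's `PMF.tvDist`) [Goldreich2001].

## Design and what is NOT here

* `K` is both the number of dyadic levels summed and (in the route) the top resolution; the
  coarsening family is indexed by all `j : ℕ` and only `j ≤ K` matter (`multiResTV_congr`).
* The READING laws of a percolation configuration (G02 `discreteCrossing` between dyadic boundary
  segments), the state space with its duality/`D₄` structure (`defn-BoxArcState`) and the claim that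
  coarsening the resolution-`K` reading gives the resolution-`j` reading (exactness of OR-fusion, a
  lemma about discrete arcs of unions of segments) are NOT here.
-/


noncomputable section

open scoped ENNReal

namespace Literature.Probability.Percolation

variable {α : Type*}

/-! ### Total variation on a finite type, in real coordinates -/

/-- **Total variation in coordinates**: `tvFin f g = ½ ∑_s |f s − g s|` for two real mass vectors on a
finite type — the route's inlined `TV_j := (1 / 2) * ∑ M, |P_ℤ²(E_M) − P_𝕋(E'_M)|`. For probability
mass functions this is the statistical (total-variation) distance (`tvDist_eq_tvFin`).
[cite: Goldreich2001, §3.2.1] -/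
def tvFin [Fintype α] (f g : α → ℝ) : ℝ :=
  (1 / 2 : ℝ) * ∑ s, |f s - g s|

/-- `tvFin f f = 0`. [folklore] -/
@[simp] theorem tvFin_self [Fintype α] (f : α → ℝ) : tvFin f f = 0 := by
  simp [tvFin]

/-- `tvFin` is symmetric. [folklore] -/
theorem tvFin_comm [Fintype α] (f g : α → ℝ) : tvFin f g = tvFin g f := by
  simp [tvFin, abs_sub_comm]

/-- `tvFin` is nonnegative. [folklore] -/
theorem tvFin_nonneg [Fintype α] (f g : α → ℝ) : 0 ≤ tvFin f g :=
  mul_nonneg (by norm_num) (Finset.sum_nonneg fun s _ => abs_nonneg _)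

/-- Triangle inequality for `tvFin`. [folklore] -/
theorem tvFin_triangle [Fintype α] (f g h : α → ℝ) : tvFin f h ≤ tvFin f g + tvFin g h := by
  rw [tvFin, tvFin, tvFin, ← mul_add, ← Finset.sum_add_distrib]
  exact mul_le_mul_of_nonneg_left (Finset.sum_le_sum fun s _ => abs_sub_le _ _ _) (by norm_num)

/-- Two probability vectors are at `tvFin`-distance at most `1` (`|f − g| ≤ f + g` termwise).
[cite: Goldreich2001, §3.2.1] -/
theorem tvFin_le_one [Fintype α] {f g : α → ℝ} (hf : ∀ s, 0 ≤ f s) (hg : ∀ s, 0 ≤ g s)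
    (hf1 : ∑ s, f s = 1) (hg1 : ∑ s, g s = 1) : tvFin f g ≤ 1 := by
  have h : ∑ s, |f s - g s| ≤ 2 := by
    calc ∑ s, |f s - g s| ≤ ∑ s, (f s + g s) :=
          Finset.sum_le_sum fun s _ =>
            abs_sub_le_iff.2 ⟨by linarith [hf s, hg s], by linarith [hf s, hg s]⟩
      _ = 2 := by rw [Finset.sum_add_distrib, hf1, hg1]; norm_num
  unfold tvFin
  linarith

/-- **On a finite type `PMF.tvDist` is `tvFin` of the real coordinates**:
`Δ(p, q) = tvFin (a ↦ (p a).toReal) (a ↦ (q a).toReal)`. [cite: Goldreich2001, §3.2.1] -/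
theorem tvDist_eq_tvFin [Fintype α] (p q : PMF α) :
    p.tvDist q = tvFin (fun a => (p a).toReal) (fun a => (q a).toReal) := by
  rw [PMF.tvDist, tsum_fintype, tvFin, one_div]

/-! ### Discounted multiresolution sums -/

/-- The weight of resolution `j` at rate `σ`: `2^{-(σ·j)}` (real power, literally the route's
`(2 : ℝ) ^ (-(σ * (j : ℝ)))`). [folklore] -/
def multiResWeight (σ : ℝ) (j : ℕ) : ℝ :=
  (2 : ℝ) ^ (-(σ * (j : ℝ)))

/-- The weights are positive. [folklore] -/
theorem multiResWeight_pos (σ : ℝ) (j : ℕ) : 0 < multiResWeight σ j :=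
  Real.rpow_pos_of_pos two_pos _

/-- `2^{-(σ j)} = (2^{-σ})^j`: the weights form a geometric progression of ratio `2^{-σ}`. [folklore] -/
theorem multiResWeight_eq_pow (σ : ℝ) (j : ℕ) : multiResWeight σ j = ((2 : ℝ) ^ (-σ)) ^ j := by
  rw [multiResWeight, ← neg_mul, Real.rpow_mul zero_le_two, Real.rpow_natCast]

/-- `multiResWeight σ 0 = 1`. [folklore] -/
@[simp] theorem multiResWeight_zero (σ : ℝ) : multiResWeight σ 0 = 1 := by
  simp [multiResWeight]

/-- For `σ ≥ 0` the weights are at most `1`. [folklore] -/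
theorem multiResWeight_le_one {σ : ℝ} (hσ : 0 ≤ σ) (j : ℕ) : multiResWeight σ j ≤ 1 :=
  Real.rpow_le_one_of_one_le_of_nonpos one_le_two
    (neg_nonpos.2 (mul_nonneg hσ (Nat.cast_nonneg j)))

/-- `2^{σ j} · 2^{-(σ j)} = 1`. [folklore] -/
theorem rpow_mul_multiResWeight (σ : ℝ) (j : ℕ) :
    (2 : ℝ) ^ (σ * (j : ℝ)) * multiResWeight σ j = 1 := by
  rw [multiResWeight, ← Real.rpow_add two_pos, add_neg_cancel, Real.rpow_zero]

/-- **Geometric bound on the total weight**: `∑_{j ≤ K} 2^{-σ j} ≤ (1 − 2^{-σ})⁻¹` for `σ > 0`.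
[folklore] -/
theorem sum_multiResWeight_le {σ : ℝ} (hσ : 0 < σ) (K : ℕ) :
    ∑ j ∈ Finset.range (K + 1), multiResWeight σ j ≤ (1 - (2 : ℝ) ^ (-σ))⁻¹ := by
  have h0 : 0 ≤ (2 : ℝ) ^ (-σ) := Real.rpow_nonneg zero_le_two _
  have h1 : (2 : ℝ) ^ (-σ) < 1 := Real.rpow_lt_one_of_one_lt_of_neg one_lt_two (neg_lt_zero.2 hσ)
  simp_rw [multiResWeight_eq_pow]
  rw [← tsum_geometric_of_lt_one h0 h1]
  exact (summable_geometric_of_lt_one h0 h1).sum_le_tsum _ fun j _ => pow_nonneg h0 j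

/-- **The discounted multiresolution sum** `multiResSum σ K d = ∑_{j ∈ range (K+1)} 2^{-(σ·j)} · d j`
of a sequence of per-resolution discrepancies `d : ℕ → ℝ` — literally the route's inlined
`Dw σ δ₀ K u u' := ∑ j ∈ Finset.range (K + 1), (2 : ℝ) ^ (-(σ * (j : ℝ))) * TV δ₀ j u u'` with
`d j = TV δ₀ j u u'`. [folklore] -/
def multiResSum (σ : ℝ) (K : ℕ) (d : ℕ → ℝ) : ℝ :=
  ∑ j ∈ Finset.range (K + 1), (2 : ℝ) ^ (-(σ * (j : ℝ))) * d j

section MultiResSum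

variable {σ : ℝ} {K : ℕ} {d d' : ℕ → ℝ}

/-- Unfolding, with the weights named. [folklore] -/
theorem multiResSum_eq_sum_weight (σ : ℝ) (K : ℕ) (d : ℕ → ℝ) :
    multiResSum σ K d = ∑ j ∈ Finset.range (K + 1), multiResWeight σ j * d j := rfl

/-- Nonnegative discrepancies give a nonnegative sum. [folklore] -/
theorem multiResSum_nonneg (h : ∀ j, 0 ≤ d j) : 0 ≤ multiResSum σ K d :=
  Finset.sum_nonneg fun j _ => mul_nonneg (multiResWeight_pos σ j).le (h j)

/-- Monotone in the discrepancies (only the levels `j ≤ K` matter). [folklore] -/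
theorem multiResSum_mono (h : ∀ j ≤ K, d j ≤ d' j) : multiResSum σ K d ≤ multiResSum σ K d' :=
  Finset.sum_le_sum fun j hj =>
    mul_le_mul_of_nonneg_left (h j (Nat.lt_succ_iff.1 (Finset.mem_range.1 hj)))
      (multiResWeight_pos σ j).le

/-- The sum only depends on the levels `j ≤ K`. [folklore] -/
theorem multiResSum_congr (h : ∀ j ≤ K, d j = d' j) : multiResSum σ K d = multiResSum σ K d' :=
  Finset.sum_congr rfl fun j hj => by rw [h j (Nat.lt_succ_iff.1 (Finset.mem_range.1 hj))]

/-- Additivity in the discrepancies. [folklore] -/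
theorem multiResSum_add (σ : ℝ) (K : ℕ) (d d' : ℕ → ℝ) :
    multiResSum σ K (fun j => d j + d' j) = multiResSum σ K d + multiResSum σ K d' := by
  simp only [multiResSum, mul_add, Finset.sum_add_distrib]

/-- Homogeneity: `multiResSum σ K (c • d) = c · multiResSum σ K d`. [folklore] -/
theorem multiResSum_const_mul (σ : ℝ) (K : ℕ) (c : ℝ) (d : ℕ → ℝ) :
    multiResSum σ K (fun j => c * d j) = c * multiResSum σ K d := by
  simp only [multiResSum, Finset.mul_sum]
  exact Finset.sum_congr rfl fun j _ => by ring

/-- The zero sequence has sum `0`. [folklore] -/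
@[simp] theorem multiResSum_zero (σ : ℝ) (K : ℕ) : multiResSum σ K (fun _ => 0) = 0 := by
  simp [multiResSum]

/-- At `K = 0` only the coarsest level counts, with weight `1`. [folklore] -/
@[simp] theorem multiResSum_zero_right (σ : ℝ) (d : ℕ → ℝ) : multiResSum σ 0 d = d 0 := by
  simp [multiResSum]

/-- Peeling off the finest level: `multiResSum σ (K+1) d = multiResSum σ K d + 2^{-σ(K+1)} d (K+1)`.
[folklore] -/
theorem multiResSum_succ (σ : ℝ) (K : ℕ) (d : ℕ → ℝ) :
    multiResSum σ (K + 1) d = multiResSum σ K d + multiResWeight σ (K + 1) * d (K + 1) := by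
  rw [multiResSum, Finset.sum_range_succ]
  rfl

/-- **Monotone in `K`** for nonnegative discrepancies (more levels, larger sum). [folklore] -/
theorem multiResSum_mono_left {K K' : ℕ} (hK : K ≤ K') (hd : ∀ j, 0 ≤ d j) :
    multiResSum σ K d ≤ multiResSum σ K' d :=
  Finset.sum_le_sum_of_subset_of_nonneg (Finset.range_mono (Nat.succ_le_succ hK))
    fun j _ _ => mul_nonneg (multiResWeight_pos σ j).le (hd j)

/-- **One level is dominated by the sum**: `2^{-σ j} d j ≤ multiResSum σ K d` for `j ≤ K` and
nonnegative `d`. [folklore] -/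
theorem weight_mul_le_multiResSum (hd : ∀ i, 0 ≤ d i) {j : ℕ} (hj : j ≤ K) :
    multiResWeight σ j * d j ≤ multiResSum σ K d :=
  Finset.single_le_sum (f := fun i => multiResWeight σ i * d i)
    (fun i _ => mul_nonneg (multiResWeight_pos σ i).le (hd i))
    (Finset.mem_range.2 (Nat.lt_succ_of_le hj))

/-- The same, solved for the level: `d j ≤ 2^{σ j} · multiResSum σ K d` (`j ≤ K`, `d ≥ 0`) — the form
`TV_j ≤ 2^{σ j} Dw_K` used by the route's `ContractionGivesMerging`. [folklore] -/
theorem le_rpow_mul_multiResSum (hd : ∀ i, 0 ≤ d i) {j : ℕ} (hj : j ≤ K) :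
    d j ≤ (2 : ℝ) ^ (σ * (j : ℝ)) * multiResSum σ K d :=
  calc d j = (2 : ℝ) ^ (σ * (j : ℝ)) * (multiResWeight σ j * d j) := by
        rw [← mul_assoc, rpow_mul_multiResWeight, one_mul]
    _ ≤ (2 : ℝ) ^ (σ * (j : ℝ)) * multiResSum σ K d :=
        mul_le_mul_of_nonneg_left (weight_mul_le_multiResSum hd hj) (Real.rpow_nonneg zero_le_two _)

/-- Discrepancies bounded by `1` give a sum bounded by the total weight `∑_{j ≤ K} 2^{-σ j}`.
[folklore] -/
theorem multiResSum_le_sum_weight (h : ∀ j ≤ K, d j ≤ 1) :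
    multiResSum σ K d ≤ ∑ j ∈ Finset.range (K + 1), multiResWeight σ j := by
  rw [multiResSum_eq_sum_weight]
  exact Finset.sum_le_sum fun j hj => by
    simpa using mul_le_mul_of_nonneg_left (h j (Nat.lt_succ_iff.1 (Finset.mem_range.1 hj)))
      (multiResWeight_pos σ j).le

/-- **Uniform bound**: `multiResSum σ K d ≤ (1 − 2^{-σ})⁻¹` for `σ > 0` and `d ≤ 1`, uniformly in `K`.
[folklore] -/
theorem multiResSum_le_of_le_one (hσ : 0 < σ) (h : ∀ j ≤ K, d j ≤ 1) :
    multiResSum σ K d ≤ (1 - (2 : ℝ) ^ (-σ))⁻¹ :=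
  (multiResSum_le_sum_weight h).trans (sum_multiResWeight_le hσ K)

end MultiResSum

/-! ### The multiresolution total-variation pseudometric on laws -/

section MultiResTV

variable {S : Type*} {T : ℕ → Type*}

/-- **The multiresolution total-variation pseudometric** of a coarsening family
`π : (j : ℕ) → S → T j` (level-`j` projection of a top-resolution state), rate `σ` and depth `K`:
`multiResTV π σ K μ ν = ∑_{j ≤ K} 2^{-σ j} · Δ(μ.map (π j), ν.map (π j))` — the laws are pushed to
each resolution and compared in total variation, fine resolutions discounted geometrically. Route
`CardyGluingRDE`: `S =` resolution-`2^K` square states, `π j =` OR-fusion to `2^j` segments per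
side (`segMultiResTV` in `MultiResTVSegments.lean`); the norm in which `GluingStability` asserts
contraction of the gluing map. [folklore] -/
def multiResTV (π : (j : ℕ) → S → T j) (σ : ℝ) (K : ℕ) (μ ν : PMF S) : ℝ :=
  multiResSum σ K fun j => (μ.map (π j)).tvDist (ν.map (π j))

variable (π : (j : ℕ) → S → T j) (σ : ℝ) (K : ℕ)

/-- Unfolding: `multiResTV π σ K μ ν = ∑_{j ∈ range (K+1)} 2^{-(σ j)} Δ(μ.map (π j), ν.map (π j))`.
[folklore] -/
theorem multiResTV_eq_sum (μ ν : PMF S) : multiResTV π σ K μ ν =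
    ∑ j ∈ Finset.range (K + 1), (2 : ℝ) ^ (-(σ * (j : ℝ))) * (μ.map (π j)).tvDist (ν.map (π j)) :=
  rfl

/-- `Dw(μ, μ) = 0`. [folklore] -/
@[simp] theorem multiResTV_self (μ : PMF S) : multiResTV π σ K μ μ = 0 := by
  simp [multiResTV]

/-- `Dw` is symmetric. [folklore] -/
theorem multiResTV_comm (μ ν : PMF S) : multiResTV π σ K μ ν = multiResTV π σ K ν μ := by
  unfold multiResTV
  exact congrArg _ (funext fun j => PMF.tvDist_comm _ _)

/-- `Dw` is nonnegative. [folklore] -/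
theorem multiResTV_nonneg (μ ν : PMF S) : 0 ≤ multiResTV π σ K μ ν :=
  multiResSum_nonneg fun _ => PMF.tvDist_nonneg _ _

/-- **Triangle inequality** for `Dw` (termwise from `PMF.tvDist`). [folklore] -/
theorem multiResTV_triangle (μ ν ρ : PMF S) :
    multiResTV π σ K μ ρ ≤ multiResTV π σ K μ ν + multiResTV π σ K ν ρ := by
  rw [multiResTV, multiResTV, multiResTV, ← multiResSum_add]
  exact multiResSum_mono fun j _ => PMF.tvDist_triangle_holds _ _ _

/-- **`Dw` as a pseudometric structure on `PMF S`** (a `def`, NOT an instance: it depends on the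
choices `π, σ, K`; use `letI := MultiResTV.pseudoMetricSpace π σ K` to speak of balls, Lipschitz /
contracting self-maps and `Metric` convergence for `Dw`). [folklore] -/
@[reducible] def MultiResTV.pseudoMetricSpace : PseudoMetricSpace (PMF S) where
  dist := multiResTV π σ K
  dist_self := multiResTV_self π σ K
  dist_comm := multiResTV_comm π σ K
  dist_triangle := multiResTV_triangle π σ K

/-- With the structure `MultiResTV.pseudoMetricSpace π σ K`, `dist = multiResTV π σ K`. [folklore] -/
theorem MultiResTV.dist_eq (μ ν : PMF S) :
    (MultiResTV.pseudoMetricSpace π σ K).dist μ ν = multiResTV π σ K μ ν := rfl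

/-- Only the projections at levels `j ≤ K` matter. [folklore] -/
theorem multiResTV_congr {π π' : (j : ℕ) → S → T j} (h : ∀ j ≤ K, π j = π' j) (μ ν : PMF S) :
    multiResTV π σ K μ ν = multiResTV π' σ K μ ν :=
  multiResSum_congr fun j hj => by rw [h j hj]

/-- **One resolution is dominated**: `2^{-σ j} Δ(π_j μ, π_j ν) ≤ Dw(μ, ν)` for `j ≤ K`. [folklore] -/
theorem weight_mul_tvDist_le_multiResTV {j : ℕ} (hj : j ≤ K) (μ ν : PMF S) :
    multiResWeight σ j * (μ.map (π j)).tvDist (ν.map (π j)) ≤ multiResTV π σ K μ ν :=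
  weight_mul_le_multiResSum (d := fun j => (μ.map (π j)).tvDist (ν.map (π j)))
    (fun _ => PMF.tvDist_nonneg _ _) hj

/-- The same solved for the resolution-`j` distance: `Δ(π_j μ, π_j ν) ≤ 2^{σ j} Dw(μ, ν)` (`j ≤ K`).
[folklore] -/
theorem tvDist_map_le_rpow_mul_multiResTV {j : ℕ} (hj : j ≤ K) (μ ν : PMF S) :
    (μ.map (π j)).tvDist (ν.map (π j)) ≤ (2 : ℝ) ^ (σ * (j : ℝ)) * multiResTV π σ K μ ν :=
  le_rpow_mul_multiResSum (d := fun j => (μ.map (π j)).tvDist (ν.map (π j)))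
    (fun _ => PMF.tvDist_nonneg _ _) hj

/-- `Dw ≤ ∑_{j ≤ K} 2^{-σ j}` (each total-variation distance is at most `1`). [folklore] -/
theorem multiResTV_le_sum_weight (μ ν : PMF S) :
    multiResTV π σ K μ ν ≤ ∑ j ∈ Finset.range (K + 1), multiResWeight σ j :=
  multiResSum_le_sum_weight fun _ _ => PMF.tvDist_le_one_holds _ _

/-- **`Dw ≤ (1 − 2^{-σ})⁻¹`**, uniformly in `K`, for `σ > 0`. [folklore] -/
theorem multiResTV_le {σ : ℝ} (hσ : 0 < σ) (μ ν : PMF S) :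
    multiResTV π σ K μ ν ≤ (1 - (2 : ℝ) ^ (-σ))⁻¹ :=
  multiResSum_le_of_le_one hσ fun _ _ => PMF.tvDist_le_one_holds _ _

/-- **Data processing**: every projected distance is at most `Δ(μ, ν)`, so
`Dw(μ, ν) ≤ (∑_{j ≤ K} 2^{-σ j}) · Δ(μ, ν)` — `Dw` is dominated by the plain total variation.
[folklore] -/
theorem multiResTV_le_sum_weight_mul_tvDist (μ ν : PMF S) :
    multiResTV π σ K μ ν ≤ (∑ j ∈ Finset.range (K + 1), multiResWeight σ j) * μ.tvDist ν := by
  rw [Finset.sum_mul, multiResTV, multiResSum_eq_sum_weight]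
  exact Finset.sum_le_sum fun j _ =>
    mul_le_mul_of_nonneg_left (PMF.tvDist_map_le_holds _ _ _) (multiResWeight_pos σ j).le

/-- **Monotone in the depth `K`** (for a fixed coarsening family): adding finer levels can only
increase `Dw`. [folklore] -/
theorem multiResTV_mono {K K' : ℕ} (hK : K ≤ K') (μ ν : PMF S) :
    multiResTV π σ K μ ν ≤ multiResTV π σ K' μ ν :=
  multiResSum_mono_left hK fun _ => PMF.tvDist_nonneg _ _

/-- Peeling off the finest level. [folklore] -/
theorem multiResTV_succ (μ ν : PMF S) : multiResTV π σ (K + 1) μ ν =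
    multiResTV π σ K μ ν + multiResWeight σ (K + 1) * (μ.map (π (K + 1))).tvDist (ν.map (π (K + 1))) :=
  multiResSum_succ σ K _

/-- **Consistency along the tower**: coarsening finer laws by `p : S' → S` first and then projecting
is projecting by the composite family `j ↦ π j ∘ p`:
`Dw_{π ∘ p}(μ, ν) = Dw_π(μ.map p, ν.map p)`. [folklore] -/
theorem multiResTV_comp {S' : Type*} (p : S' → S) (μ ν : PMF S') :
    multiResTV (fun j => π j ∘ p) σ K μ ν = multiResTV π σ K (μ.map p) (ν.map p) := by
  simp only [multiResTV, PMF.map_comp]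

/-- **Bridge to real coordinates**: if the real vectors `v j`, `w j` on the (finite) level-`j` state
spaces are the coordinates of the projected laws for every `j ≤ K`, then the discounted sum of the
coordinate total variations `tvFin (v j) (w j)` IS `multiResTV` — the form in which a route that
inlines per-resolution laws as real vectors meets this definition. [folklore] -/
theorem multiResSum_tvFin_eq_multiResTV [∀ j, Fintype (T j)] {v w : (j : ℕ) → T j → ℝ}
    {μ ν : PMF S} (hv : ∀ j ≤ K, ∀ x, (μ.map (π j) x).toReal = v j x)
    (hw : ∀ j ≤ K, ∀ x, (ν.map (π j) x).toReal = w j x) :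
    multiResSum σ K (fun j => tvFin (v j) (w j)) = multiResTV π σ K μ ν :=
  multiResSum_congr fun j hj => by
    rw [tvDist_eq_tvFin]
    exact congrArg₂ tvFin (funext fun x => (hv j hj x).symm) (funext fun x => (hw j hj x).symm)

end MultiResTV

end Literature.Probability.Percolation

end
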